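import Summits.ResolutionOfSingularities.ResolutionOfSingularities.Theorems.WeightedInvariantIotaMaxStratum
import Summits.ResolutionOfSingularities.ResolutionOfSingularities.Theorems.WeightedInvariantHypersurfaceCentreAssemblyDefs
import Summits.ResolutionOfSingularities.ResolutionOfSingularities.Theorems.WeightedInvariantHypersurfaceLocalGameEFT3
import Literature.AlgebraicGeometry.Resolution.NonPrincipalLocus
import Literature.AlgebraicGeometry.Resolution.RegularLocalRingsJacobian
import HarnessLib

/-!
# Door assembly H2c″ — sub-stub [S1] `stub_maxLocus` BY NAME

Route `ResolutionOfSingularities/WeightedInvariant`, crux `Theses.WeightedInvariant.HypersurfaceCentreConstruction`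
(stmt-ResolutionOfSingularities-19897), door line `local-engine`, H2c″ assembly decomposition of record
(`door_assembly_eft3_v1.lean` of res-L1-w43-stub-9 = res-D-brk-1, sha16 c97a3399deb30939; res-L1-w43-plan-1 ORDER (o14)(B)
/ (o17)).  The objects are the TREE constants of `WeightedInvariantHypersurfaceCentreAssemblyDefs` (`localGenerator`,
`iotaAt`, `iotaMax`, `maxLocus`) and the clause predicates of `WeightedInvariantHypersurfaceLocalGameEFT3`
(`IotaIsoInvariant` (c6), `IotaUpperSemicontinuous` (c8), `IotaUnitInvariant` (c12a/TP4)).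

* `stub_maxLocus` — **[S1]** (signature VERBATIM from the door skeleton v3c candidate 1d05f2918dd57d34, l.111–115):
  for `ι` satisfying (c6), (c8), (TP4), over a perfect field `k` of characteristic `p`, a smooth separated quasi-compact
  `Y → Spec k` and a locally principal ideal sheaf `X` with `V(X)` integral and not regular, the maximum locus
  `maxLocus ι X = {y ∈ singImage X | ι(𝒪_{Y,y}, f_y) = ⨆_{singImage X} ι}` is closed and non-empty
  (`stub_maxLocus'`: also `⊆ singImage X`, over any field, without separatedness/integrality).  Proof: the def-free core `isClosed_iotaMaxLocus_of_stalkGenerators` of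
  `WeightedInvariantIotaMaxStratum` at the generator family `localGenerator X` (which generates the stalks because `X`
  is locally principal, `IsLocallyPrincipalAt.isPrincipal_stalkIdeal`).  The hypotheses `CharP`/`PerfectField`/
  `IsSeparated`/`IsIntegral` of the registered shape are carried but not used.

* two kernels for [S6] `stub_iotaMax_lt_of_step` that do not touch the cobordant blow-up:
  `iotaMax_lt_of_forall_iotaAt_lt` — AGGREGATION: if `0 < M` and every point `b` of the non-regular locus has `ι_b < M` then
  `iotaMax ι X < M` (pointwise bounds alone give only `⨆ ≤ M` below a limit ordinal; the strict bound uses ATTAINMENT of the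
  maximum, i.e. [S1] and the clause (c8), when `V(X)` is not regular, and `⨆ ∅ = 0 < M` when it is); and
  `iota_pos_of_prime` — POSITIVITY: for `ι`, `J` with (c7) `IotaGenerizationMonotone` and (c9′) `CanonicalGameClause p`, at an
  e.f.t. regular local position `(S, f)` over a perfect field of characteristic `p` with `f` PRIME and `f ∈ 𝔪²`, `0 < ι(S, f)`
  (the stratum prime `P` is not below `(f)`, else `S ⧸ (f)` would be regular — `not_isRegularLocalRing_quotient_span_singleton_of_mem_sq`;
  so (strat) gives `ι(S_{(f)}, f) ≠ ι(S, f)` and (c7) gives `<`).  This keeps [S6] strict when the successor is already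
  regular (`iotaMax = 0` there): the door's hypersurfaces are integral, so local equations are prime and `iotaMax ≥ 1`.

Nothing here asserts any clause: (c6)/(c7)/(c8)/(c9′)/(TP4) are hypotheses on arbitrary `ι`, `J`.  AI-written; weaker than
expert review.
-/

noncomputable section

set_option linter.dupNamespace false -- mandated namespace of this single-conjunct summit

open CategoryTheory AlgebraicGeometry TopologicalSpace IsLocalRing
open Literature.AlgebraicGeometry.Resolution
open Summit.ResolutionOfSingularities.ResolutionOfSingularities.Theorems

namespace Summit.ResolutionOfSingularities.ResolutionOfSingularities.Cruxes.HypersurfaceCentreConstruction.LocalEngine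

variable {p : ℕ} (ι : (R : Type) → [CommRing R] → R → Ordinal.{0})
  (J : (R : Type) → [CommRing R] → R → ℕ → Ideal R)

/-- On a locally principal ideal sheaf, `localGenerator X y` generates the stalk `X_y` at every point. [folklore] -/
theorem stalkIdeal_eq_span_localGenerator_of_isLocallyPrincipal {Y : Scheme.{0}} (X : Y.IdealSheafData)
    (hX : IsLocallyPrincipal X) (y : Y) : stalkIdeal X y = Ideal.span {localGenerator X y} :=
  stalkIdeal_eq_span_localGenerator X y (hX y).isPrincipal_stalkIdeal.principal

/-- **[S1] The maximum locus is closed, lies in the non-regular locus, and is non-empty when `V(X)` is not regular**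
((c8) on the principal charts of `X` + (c6) through the stalk isomorphisms of the charts + (TP4) unit-invariance for
the choice of local equation; finitely many values of an ordinal function with closed superlevel sets on the
Noetherian space `|Y|` — `isClosed_iotaMaxLocus_of_stalkGenerators`). [folklore] -/
theorem stub_maxLocus (hc6 : IotaIsoInvariant ι) (hc8 : IotaUpperSemicontinuous ι) (hu : IotaUnitInvariant ι)
    {k : Type} [Field k] [CharP k p] [PerfectField k] {Y : Scheme.{0}} (f : Y ⟶ Spec (.of k)) [Smooth f]
    [IsSeparated f] [QuasiCompact f] (X : Y.IdealSheafData) (hX : IsLocallyPrincipal X)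
    (hXi : IsIntegral X.subscheme) (hsing : ¬ Scheme.IsRegular X.subscheme) :
    IsClosed (maxLocus ι X) ∧ (maxLocus ι X).Nonempty := by
  -- `hXi` (integrality of `V(X)`) is part of the registered shape; the proof does not need it
  have _hint : IsIntegral X.subscheme := hXi
  have h := isClosed_iotaMaxLocus_of_stalkGenerators ι hc6 hc8 (fun R _ v g => hu R (v : R) g v.isUnit) f X hX
    hsing (fun y => localGenerator X y) (stalkIdeal_eq_span_localGenerator_of_isLocallyPrincipal X hX)
  exact ⟨h.1, h.2.1⟩

/-- [S1] with the inclusion `maxLocus ι X ⊆ singImage X` recorded as well (the shape of stub-9's sketch v1).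
[folklore] -/
theorem stub_maxLocus' (hc6 : IotaIsoInvariant ι) (hc8 : IotaUpperSemicontinuous ι) (hu : IotaUnitInvariant ι)
    {k : Type} [Field k] {Y : Scheme.{0}} (f : Y ⟶ Spec (.of k)) [Smooth f] [QuasiCompact f]
    (X : Y.IdealSheafData) (hX : IsLocallyPrincipal X) (hsing : ¬ Scheme.IsRegular X.subscheme) :
    IsClosed (maxLocus ι X) ∧ (maxLocus ι X).Nonempty ∧ maxLocus ι X ⊆ singImage X :=
  isClosed_iotaMaxLocus_of_stalkGenerators ι hc6 hc8 (fun R _ v g => hu R (v : R) g v.isUnit) f X hX hsing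
    (fun y => localGenerator X y) (stalkIdeal_eq_span_localGenerator_of_isLocallyPrincipal X hX)

/-- **[S1], maximum-point form**: some point of the non-regular locus maximises `iotaAt ι X` over it, and there
`iotaAt = iotaMax`. [folklore] -/
theorem exists_mem_singImage_iotaAt_eq_iotaMax (hc6 : IotaIsoInvariant ι) (hc8 : IotaUpperSemicontinuous ι)
    (hu : IotaUnitInvariant ι) {k : Type} [Field k] {Y : Scheme.{0}} (f : Y ⟶ Spec (.of k)) [Smooth f]
    [QuasiCompact f] (X : Y.IdealSheafData) (hX : IsLocallyPrincipal X) (hsing : ¬ Scheme.IsRegular X.subscheme) :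
    ∃ y₀ ∈ singImage X, (∀ y ∈ singImage X, iotaAt ι X y ≤ iotaAt ι X y₀) ∧ iotaAt ι X y₀ = iotaMax ι X := by
  obtain ⟨y₀, hy₀, hmax⟩ := exists_isMaxOn_iota_singImage ι hc6 hc8 (fun R _ v g => hu R (v : R) g v.isUnit)
    f X hX hsing (fun y => localGenerator X y) (stalkIdeal_eq_span_localGenerator_of_isLocallyPrincipal X hX)
  exact ⟨y₀, hy₀, hmax, (iSup_eq_of_isMaxOn (fun y => iotaAt ι X y) hy₀ hmax).symm⟩

/-- The maximum locus is the trace on the non-regular locus of the top superlevel set `{ι_max ≤ ι}`. [folklore] -/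
theorem maxLocus_eq_inter_superlevel {Y : Scheme.{0}} (X : Y.IdealSheafData) :
    maxLocus ι X = singImage X ∩ {y | iotaMax ι X ≤ iotaAt ι X y} := by
  ext y
  simp only [maxLocus, Set.mem_setOf_eq, Set.mem_inter_iff]
  constructor
  · rintro ⟨hy, heq⟩
    exact ⟨hy, heq.ge⟩
  · rintro ⟨hy, hge⟩
    exact ⟨hy, le_antisymm (iotaAt_le_iotaMax ι X hy) hge⟩

/-- Off the maximum locus, a point of the non-regular locus has `ι` strictly below the maximum. [folklore] -/
theorem iotaAt_lt_iotaMax_of_not_mem_maxLocus {Y : Scheme.{0}} (X : Y.IdealSheafData) {y : Y}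
    (hy : y ∈ singImage X) (hyM : y ∉ maxLocus ι X) : iotaAt ι X y < iotaMax ι X :=
  lt_of_le_of_ne (iotaAt_le_iotaMax ι X hy) fun h => hyM ⟨hy, h⟩

/-! ## Aggregation: a strict pointwise bound on the non-regular locus bounds `iotaMax` strictly -/

/-- On a pair whose hypersurface is REGULAR the maximum of `ι` over the (empty) non-regular locus is `0`. [folklore] -/
theorem iotaMax_eq_zero_of_isRegular {Y : Scheme.{0}} (X : Y.IdealSheafData) (hreg : Scheme.IsRegular X.subscheme) :
    iotaMax ι X = 0 := by
  have hempty : singImage X = ∅ := by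
    by_contra hne
    exact (singImage_nonempty_iff X).mp (Set.nonempty_iff_ne_empty.mpr hne) hreg
  haveI : IsEmpty {y : Y // y ∈ singImage X} := by
    rw [hempty]
    infer_instance
  rw [iotaMax, ciSup_of_empty, Ordinal.bot_eq_zero]

/-- **Aggregation kernel for [S6].**  `Y` smooth quasi-compact over a field, `X` locally principal, `ι` with (c6), (c8),
(TP4).  If `0 < M` and every point `b` of the non-regular locus of `V(X)` has `iotaAt ι X b < M`, then `iotaMax ι X < M`:
when `V(X)` is regular `iotaMax = 0 < M`; otherwise the maximum is attained at some `b₀` ([S1],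
`exists_mem_singImage_iotaAt_eq_iotaMax`) and `iotaMax = ι_{b₀} < M`. [folklore] -/
theorem iotaMax_lt_of_forall_iotaAt_lt (hc6 : IotaIsoInvariant ι) (hc8 : IotaUpperSemicontinuous ι)
    (hu : IotaUnitInvariant ι) {k : Type} [Field k] {Y : Scheme.{0}} (f : Y ⟶ Spec (.of k)) [Smooth f]
    [QuasiCompact f] (X : Y.IdealSheafData) (hX : IsLocallyPrincipal X) {M : Ordinal.{0}} (hM : 0 < M)
    (h : ∀ b ∈ singImage X, iotaAt ι X b < M) : iotaMax ι X < M := by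
  by_cases hreg : Scheme.IsRegular X.subscheme
  · rw [iotaMax_eq_zero_of_isRegular ι X hreg]
    exact hM
  · obtain ⟨b₀, hb₀, -, heq⟩ := exists_mem_singImage_iotaAt_eq_iotaMax ι hc6 hc8 hu f X hX hreg
    rw [← heq]
    exact h b₀ hb₀

/-- The same with the bound read off the maximum of ANOTHER pair: if every point of the non-regular locus of `V(X′)` has
`ι` strictly below `iotaMax ι X` and the latter is positive, then `iotaMax ι X′ < iotaMax ι X` — the shape [S6] concludes
with. [folklore] -/
theorem iotaMax_lt_iotaMax_of_forall_iotaAt_lt (hc6 : IotaIsoInvariant ι) (hc8 : IotaUpperSemicontinuous ι)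
    (hu : IotaUnitInvariant ι) {k : Type} [Field k] {Y Y' : Scheme.{0}} (f' : Y' ⟶ Spec (.of k)) [Smooth f']
    [QuasiCompact f'] (X : Y.IdealSheafData) (X' : Y'.IdealSheafData) (hX' : IsLocallyPrincipal X')
    (hM : 0 < iotaMax ι X) (h : ∀ b ∈ singImage X', iotaAt ι X' b < iotaMax ι X) :
    iotaMax ι X' < iotaMax ι X :=
  iotaMax_lt_of_forall_iotaAt_lt ι hc6 hc8 hu f' X' hX' hM h

/-! ## Positivity of `ι` at prime positions -/

/-- **`0 < ι` at a PRIME singular position.**  For `ι`, `J` with (c7) `IotaGenerizationMonotone` and the canonical game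
clause (c9′) in characteristic `p`: at an e.f.t. regular local position `(S, f)` over a perfect field of characteristic `p`
with `f` prime and `f ∈ 𝔪_S²`, `0 < ι(S, f)`.  The stratum prime `P` of (c9′) is not below `(f)` — otherwise `P = (f)` and
`S ⧸ (f)` would be regular, impossible for `f ∈ 𝔪²` (`not_isRegularLocalRing_quotient_span_singleton_of_mem_sq`) — so by
(strat) `ι(S_{(f)}, f) ≠ ι(S, f)` and by (c7) `ι(S_{(f)}, f) < ι(S, f)`. [folklore] -/
theorem iota_pos_of_prime (hc7 : IotaGenerizationMonotone ι) (hgame : CanonicalGameClause p ι J)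
    (k₀ : Type) [Field k₀] [CharP k₀ p] [PerfectField k₀] {S : Type} [CommRing S] [Algebra k₀ S]
    [Algebra.EssFiniteType k₀ S] [IsRegularLocalRing S] {f : S} (hf : Prime f)
    (hf2 : f ∈ (maximalIdeal S) ^ 2) : 0 < ι S f := by
  obtain ⟨P, hP, hPreg, hfP, hstrat, -, -⟩ := hgame k₀ S f hf.ne_zero hf2
  haveI : (Ideal.span {f}).IsPrime := (Ideal.span_singleton_prime hf.ne_zero).mpr hf
  -- the stratum prime is not below `(f)`
  have hnle : ¬ P ≤ Ideal.span {f} := by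
    intro hle
    have heq : P = Ideal.span {f} := le_antisymm hle ((Ideal.span_singleton_le_iff_mem _).mpr hfP)
    rw [heq] at hPreg
    exact not_isRegularLocalRing_quotient_span_singleton_of_mem_sq hf.ne_zero hf2 hPreg
  -- (strat) at the prime `(f)`: the value there differs from `ι(S, f)`; (c7): it is at most `ι(S, f)`
  have hne : ι (Localization.AtPrime (Ideal.span {f}))
      (algebraMap S (Localization.AtPrime (Ideal.span {f})) f) ≠ ι S f :=
    fun heq => hnle ((hstrat (Ideal.span {f}) (Ideal.mem_span_singleton_self f)).mp heq)
  have hle := hc7 S (Ideal.span {f}) f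
  exact lt_of_le_of_lt zero_le (lt_of_le_of_ne hle hne)

/-- `1 ≤ ι` at a prime singular position (ordinal form of `iota_pos_of_prime`). [folklore] -/
theorem one_le_iota_of_prime (hc7 : IotaGenerizationMonotone ι) (hgame : CanonicalGameClause p ι J)
    (k₀ : Type) [Field k₀] [CharP k₀ p] [PerfectField k₀] {S : Type} [CommRing S] [Algebra k₀ S]
    [Algebra.EssFiniteType k₀ S] [IsRegularLocalRing S] {f : S} (hf : Prime f)
    (hf2 : f ∈ (maximalIdeal S) ^ 2) : 1 ≤ ι S f :=
  Order.one_le_iff_pos.mpr (iota_pos_of_prime ι J hc7 hgame k₀ hf hf2)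

end Summit.ResolutionOfSingularities.ResolutionOfSingularities.Cruxes.HypersurfaceCentreConstruction.LocalEngine

end
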